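import Mathlib
import HarnessLib

/-!
# Crux `TropicalWeilVanishing` (stmt-HodgeConjecture-18478) — CM-WEIGHT SEPARATION: the characters
# `c ↦ cᵏ·c̄ˡ` of the Gaussian-integer isogeny monoid are linearly independent (the engine of Theorem F1:
# no POLYNOMIAL Kontsevich-type certificate sees the Weil directions)

Route `TropicalWeilObstruction` of `HodgeConjecture`; cell `pub-hodge-tropical` (Hodge NEGATION SINK — scoped exploration,
cap 2 seats, no summit claim), seat tropical-2 gen 15 (`prover-pub-hodge-tropical-2-g15-0`, 2026-08-24), written while
REFEREEING tropical-1 gen 15's `certificates/signedcycles/PHI-ANSATZ.md` (Kontsevich's `Φ` as a periodic Stokes primitive for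
the Weil density on formal simplices; a randomized solver for POLYNOMIAL primitives). HONEST FRAMING: elementary algebra
(a complex polynomial in two variables vanishing at all integer points is zero; hence the functions
`(x, y) ↦ (x + iy)ᵏ (x − iy)ˡ` on `ℤ²` are linearly independent). It is the one algebraic step of a PAPER theorem about a METHOD
(HOME `certificates/signedcycles/referee-tropical2-g15/NO-POLYNOMIAL-WEIL-CERTIFICATE.md`, Theorem F1); it decides nothing about
K1 (`TropicalWeilVanishing`, OPEN — an open problem) and nothing here bears on the Hodge conjecture. negation-sink work.

The paper argument it serves. The scalar isogenies `k = a·1 + b·J` (integer matrices commuting with every Weil period; tree: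
`Phases.scalarIsogeny_detC`, `Phases.exists_endomorphism_transport`, p363800) map formal simplices to formal simplices, multiply
holomorphic letter-coordinates by `c = a + bi`, antiholomorphic ones by `c̄`, the `(p,q)`-components of a frame's Plücker vector by
`cᵖc̄^q`, and the Weil density `det S̄·Ω(q)²/n!` by `c^{2n}`. A POLYNOMIAL candidate primitive therefore turns the Stokes identity at
`k·σ` into a finite identity `Σ_{(κ,λ)} cᵏc̄ˡ·X_{κ,λ}(σ) = c^{2n}·v(σ)` valid for ALL Gaussian integers `c`; by the independence proved
here (`cmCharacter_linearIndependent`) it splits weight by weight, and the weight-`(2n,0)` part is `Ω(q)·(holomorphic)`, the class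
that PHI-ANSATZ §2(a) excludes (`μ(Θⁿ) > 0`). The bookkeeping of the extreme weight is `weight_extreme` / `weight_extreme'` below.
Mathlib only (`MvPolynomial.funext_set`); nothing is defined; no named fact; no sorry.

## References

* [Zharkov2020TropicalWeil] I. Zharkov, Tropical abelian varieties, Weil classes and the Hodge conjecture, arXiv:2002.02347
  (2020), pp. 2–4 (the CM `(√−d)_*` of the tropical Weil family; Kontsevich's `Φ`; the finite ansatz).
* [MikhalkinZharkov2014Eigenwave] G. Mikhalkin, I. Zharkov, Tropical eigenwave and intermediate Jacobians, LN UMI 15 (2014),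
  Prop. 4.3 (push-forward of tropical cycles).
-/

set_option linter.dupNamespace false

namespace Summit.HodgeConjecture.HodgeConjecture.Theorems.TropicalWeilVanishing.CMWeights

open MvPolynomial Complex Finsupp

/-- Two complex polynomials (any set of variables) that agree at all INTEGER points are equal — the lattice `ℤ^σ` is
Zariski dense. [folklore; Mathlib `MvPolynomial.funext_set`] -/
theorem mvPolynomial_eq_of_eval_intCast {σ : Type*} {p q : MvPolynomial σ ℂ}
    (h : ∀ x : σ → ℤ, eval (fun i => (x i : ℂ)) p = eval (fun i => (x i : ℂ)) q) : p = q := by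
  refine MvPolynomial.funext_set (fun _ => Set.range ((↑) : ℤ → ℂ)) (fun _ => ?_) ?_
  · exact Set.infinite_range_of_injective Int.cast_injective
  · intro x hx
    choose y hy using fun i => hx i (Set.mem_univ i)
    have hxy : x = fun i => (y i : ℂ) := funext fun i => (hy i).symm
    rw [hxy]
    exact h y

/-- A complex polynomial vanishing at all integer points is zero. [folklore] -/
theorem mvPolynomial_eq_zero_of_eval_intCast {σ : Type*} {p : MvPolynomial σ ℂ}
    (h : ∀ x : σ → ℤ, eval (fun i => (x i : ℂ)) p = 0) : p = 0 :=
  mvPolynomial_eq_of_eval_intCast (q := 0) (by simpa using h)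

/-- The exponent vector `(κ, λ) ↦ κ·e₀ + λ·e₁` of the monomial `Z^κ W^λ`. -/
private theorem expo_injective :
    Function.Injective (fun w : ℕ × ℕ => (single (0 : Fin 2) w.1 + single (1 : Fin 2) w.2 : Fin 2 →₀ ℕ)) := by
  intro w w' hww'
  have h0 := congrArg (fun f : Fin 2 →₀ ℕ => f 0) hww'
  have h1 := congrArg (fun f : Fin 2 →₀ ℕ => f 1) hww'
  simp only [Finsupp.add_apply, Finsupp.single_eq_same, Finsupp.single_eq_of_ne (show (0 : Fin 2) ≠ 1 by decide),
    Finsupp.single_eq_of_ne (show (1 : Fin 2) ≠ 0 by decide), add_zero, zero_add] at h0 h1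
  exact Prod.ext h0 h1

/-- `C c · (C 2 · X₀)^i · (C 2 · X₁)^j` is the monomial `Z^i W^j` with coefficient `c·2^i·2^j`. -/
private theorem term_eq_monomial (c : ℂ) (i j : ℕ) :
    C c * (C (2 : ℂ) * X (0 : Fin 2)) ^ i * (C (2 : ℂ) * X (1 : Fin 2)) ^ j =
      monomial (single (0 : Fin 2) i + single (1 : Fin 2) j) (c * 2 ^ i * 2 ^ j) := by
  rw [mul_pow, mul_pow, ← map_pow, ← map_pow, X_pow_eq_monomial, X_pow_eq_monomial]
  have : C c * (C ((2 : ℂ) ^ i) * monomial (single (0 : Fin 2) i) (1 : ℂ)) *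
      (C ((2 : ℂ) ^ j) * monomial (single (1 : Fin 2) j) (1 : ℂ)) =
      C (c * 2 ^ i * 2 ^ j) * (monomial (single (0 : Fin 2) i) (1 : ℂ) * monomial (single (1 : Fin 2) j) (1 : ℂ)) := by
    rw [map_mul, map_mul]; ring
  rw [this, monomial_mul, C_mul_monomial, mul_one, mul_one]

/-- **CM-weight separation (independence of the characters of the Gaussian-integer isogeny monoid).** If a finite
complex combination of the functions `(x, y) ↦ (x + iy)^κ (x − iy)^λ` vanishes at every point of `ℤ²` — i.e. the function
`c ↦ Σ a_{κ,λ} c^κ c̄^λ` vanishes on all Gaussian integers `c` — then every coefficient vanishes. This is the step that splits the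
Stokes identity of a POLYNOMIAL candidate primitive, transported along all scalar isogenies `x + yJ`, into its CM-weight
components (Theorem F1 of the referee note; it is what makes "ℂ^×-weights" available although only `μ₄ ⊂ ℤ[i]^×` are automorphisms).
[folklore] -/
theorem cmCharacter_linearIndependent (S : Finset (ℕ × ℕ)) (a : ℕ × ℕ → ℂ)
    (h : ∀ x y : ℤ, ∑ w ∈ S, a w * ((x : ℂ) + (y : ℂ) * I) ^ w.1 * ((x : ℂ) - (y : ℂ) * I) ^ w.2 = 0) :
    ∀ w ∈ S, a w = 0 := by
  -- the polynomial P(X₀, X₁) = Σ a_w (X₀ + i X₁)^κ (X₀ − i X₁)^λ vanishes on ℤ², hence is zero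
  set P : MvPolynomial (Fin 2) ℂ :=
    ∑ w ∈ S, C (a w) * (X 0 + C I * X 1) ^ w.1 * (X 0 - C I * X 1) ^ w.2 with hPdef
  have hP : P = 0 := by
    apply mvPolynomial_eq_zero_of_eval_intCast
    intro x
    have := h (x 0) (x 1)
    simp only [mul_comm ((x 1 : ℤ) : ℂ) I] at this
    simpa [hPdef, map_sum, map_mul, map_pow, map_add, map_sub, eval_C, eval_X] using this
  -- substitute X₀ ↦ X₀ + X₁, X₁ ↦ −i (X₀ − X₁): this sends X₀ + iX₁ ↦ 2X₀ and X₀ − iX₁ ↦ 2X₁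
  let f : Fin 2 → MvPolynomial (Fin 2) ℂ := ![X 0 + X 1, C (-I) * (X 0 - X 1)]
  have hI : C I * C (-I) = (1 : MvPolynomial (Fin 2) ℂ) := by
    rw [← map_mul]
    have : I * -I = (1 : ℂ) := by rw [mul_neg, I_mul_I, neg_neg]
    rw [this, map_one]
  have e1 : aeval f (X 0 + C I * X 1) = C (2 : ℂ) * X (0 : Fin 2) := by
    have h2 : (C (2 : ℂ) : MvPolynomial (Fin 2) ℂ) = 2 := by rw [map_ofNat]
    simp only [map_add, map_mul, aeval_X, aeval_C, MvPolynomial.algebraMap_eq, f, Matrix.cons_val_zero,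
      Matrix.cons_val_one]
    rw [← mul_assoc, hI, h2]; ring
  have e2 : aeval f (X 0 - C I * X 1) = C (2 : ℂ) * X (1 : Fin 2) := by
    have h2 : (C (2 : ℂ) : MvPolynomial (Fin 2) ℂ) = 2 := by rw [map_ofNat]
    simp only [map_sub, map_mul, aeval_X, aeval_C, MvPolynomial.algebraMap_eq, f, Matrix.cons_val_zero,
      Matrix.cons_val_one]
    rw [← mul_assoc, hI, h2]; ring
  have hQ : aeval f P =
      ∑ w ∈ S, monomial (single (0 : Fin 2) w.1 + single (1 : Fin 2) w.2) (a w * 2 ^ w.1 * 2 ^ w.2) := by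
    rw [hPdef, map_sum]
    refine Finset.sum_congr rfl fun w _ => ?_
    rw [map_mul, map_mul, map_pow, map_pow, e1, e2, aeval_C, MvPolynomial.algebraMap_eq, term_eq_monomial]
  have hQ0 : aeval f P = 0 := by rw [hP, map_zero]
  intro w hw
  have hc := congrArg (coeff (single (0 : Fin 2) w.1 + single (1 : Fin 2) w.2)) hQ
  rw [hQ0, coeff_zero, coeff_sum] at hc
  simp only [coeff_monomial] at hc
  rw [Finset.sum_congr rfl (fun w' _ => if_congr (expo_injective.eq_iff) rfl rfl), Finset.sum_ite_eq' S w,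
    if_pos hw] at hc
  have h2 : (2 : ℂ) ^ w.1 * 2 ^ w.2 ≠ 0 := mul_ne_zero (pow_ne_zero _ two_ne_zero) (pow_ne_zero _ two_ne_zero)
  have : a w * ((2 : ℂ) ^ w.1 * 2 ^ w.2) = 0 := by rw [← mul_assoc]; exact hc.symm
  exact (mul_eq_zero.mp this).resolve_right h2

/-- Corollary in the form used by Theorem F1: two finite CM-weight expansions that agree as functions on the Gaussian integers
agree coefficient by coefficient ("the transported Stokes identity splits weight by weight"). [folklore] -/
theorem cmWeight_coeff_eq (S : Finset (ℕ × ℕ)) (a b : ℕ × ℕ → ℂ)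
    (h : ∀ x y : ℤ, ∑ w ∈ S, a w * ((x : ℂ) + (y : ℂ) * I) ^ w.1 * ((x : ℂ) - (y : ℂ) * I) ^ w.2 =
      ∑ w ∈ S, b w * ((x : ℂ) + (y : ℂ) * I) ^ w.1 * ((x : ℂ) - (y : ℂ) * I) ^ w.2) :
    ∀ w ∈ S, a w = b w := by
  have := cmCharacter_linearIndependent S (fun w => a w - b w) (fun x y => by
    have hxy := h x y
    rw [← sub_eq_zero, ← Finset.sum_sub_distrib] at hxy
    simpa [sub_mul] using hxy)
  intro w hw
  exact sub_eq_zero.mp (this w hw)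

/-- The extreme-weight bookkeeping of Theorem F1: a term with `k` holomorphic and `j` antiholomorphic letters and Plücker type
`(a, b)`, `a + b = n`, has CM-weight `(k + a, j + b)`; it meets the Weil density (weight `(2n, 0)`) only if it has NO
antiholomorphic letter, type `(n, 0)` — i.e. it factors through `Ω(q)` — and exactly `n` holomorphic letters. [folklore] -/
theorem weight_extreme {n k j a b : ℕ} (hab : a + b = n) (hw : k + a = 2 * n ∧ j + b = 0) :
    j = 0 ∧ b = 0 ∧ a = n ∧ k = n := by
  omega

/-- The same bookkeeping for the compact form (PHI-ANSATZ §5, `U(1) ⊂ U(H₀)`): a `U(H₀)`-semi-invariant of weight `det²` with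
`k + j = n` letters and type `(a, b)`, `a + b = n`, has `U(1)`-weight `(k + a) − (j + b) = 2n`, which forces `j = b = 0`.
[folklore] -/
theorem weight_extreme' {n k j a b : ℕ} (hkj : k + j = n) (hab : a + b = n) (hw : (k + a : ℤ) - (j + b) = 2 * n) :
    j = 0 ∧ b = 0 ∧ a = n ∧ k = n := by
  omega


/-- A complex polynomial vanishing at all integer points of a BOX WITH INFINITE SIDES `∏ᵢ sᵢ`, `sᵢ ⊆ ℤ` infinite, is zero (e.g. a coset
`c₀ + N·ℤ^σ`, `N ≠ 0`). [folklore; Mathlib `MvPolynomial.funext_set`] -/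
theorem mvPolynomial_eq_zero_of_eval_intCast_on {σ : Type*} {p : MvPolynomial σ ℂ} (s : σ → Set ℤ)
    (hs : ∀ i, (s i).Infinite) (h : ∀ x : σ → ℤ, (∀ i, x i ∈ s i) → eval (fun i => (x i : ℂ)) p = 0) : p = 0 := by
  refine MvPolynomial.funext_set (fun i => ((↑) : ℤ → ℂ) '' s i) (fun i => ?_) ?_
  · exact (hs i).image Int.cast_injective.injOn
  · intro x hx
    choose y hy hxy using fun i => hx i (Set.mem_univ i)
    have hxy' : x = fun i => (y i : ℂ) := funext fun i => (hxy i).symm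
    rw [hxy', map_zero]
    exact h y hy

/-- The coefficient-extraction half of `cmCharacter_linearIndependent`, isolated: if the polynomial
`Σ_{w∈S} a_w (X₀ + iX₁)^{w.1} (X₀ − iX₁)^{w.2}` is zero then all `a_w` vanish (substitute `X₀ ↦ X₀ + X₁`, `X₁ ↦ −i(X₀ − X₁)`).
[folklore] -/
private theorem coeff_eq_zero_of_charPoly_eq_zero (S : Finset (ℕ × ℕ)) (a : ℕ × ℕ → ℂ)
    (hP : (∑ w ∈ S, C (a w) * (X 0 + C I * X 1) ^ w.1 * (X 0 - C I * X 1) ^ w.2 : MvPolynomial (Fin 2) ℂ) = 0) :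
    ∀ w ∈ S, a w = 0 := by
  set P : MvPolynomial (Fin 2) ℂ :=
    ∑ w ∈ S, C (a w) * (X 0 + C I * X 1) ^ w.1 * (X 0 - C I * X 1) ^ w.2 with hPdef
  let f : Fin 2 → MvPolynomial (Fin 2) ℂ := ![X 0 + X 1, C (-I) * (X 0 - X 1)]
  have hI : C I * C (-I) = (1 : MvPolynomial (Fin 2) ℂ) := by
    rw [← map_mul]
    have : I * -I = (1 : ℂ) := by rw [mul_neg, I_mul_I, neg_neg]
    rw [this, map_one]
  have e1 : aeval f (X 0 + C I * X 1) = C (2 : ℂ) * X (0 : Fin 2) := by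
    have h2 : (C (2 : ℂ) : MvPolynomial (Fin 2) ℂ) = 2 := by rw [map_ofNat]
    simp only [map_add, map_mul, aeval_X, aeval_C, MvPolynomial.algebraMap_eq, f, Matrix.cons_val_zero,
      Matrix.cons_val_one]
    rw [← mul_assoc, hI, h2]; ring
  have e2 : aeval f (X 0 - C I * X 1) = C (2 : ℂ) * X (1 : Fin 2) := by
    have h2 : (C (2 : ℂ) : MvPolynomial (Fin 2) ℂ) = 2 := by rw [map_ofNat]
    simp only [map_sub, map_mul, aeval_X, aeval_C, MvPolynomial.algebraMap_eq, f, Matrix.cons_val_zero,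
      Matrix.cons_val_one]
    rw [← mul_assoc, hI, h2]; ring
  have hQ : aeval f P =
      ∑ w ∈ S, monomial (single (0 : Fin 2) w.1 + single (1 : Fin 2) w.2) (a w * 2 ^ w.1 * 2 ^ w.2) := by
    rw [hPdef, map_sum]
    refine Finset.sum_congr rfl fun w _ => ?_
    rw [map_mul, map_mul, map_pow, map_pow, e1, e2, aeval_C, MvPolynomial.algebraMap_eq, term_eq_monomial]
  have hQ0 : aeval f P = 0 := by rw [hP, map_zero]
  intro w hw
  have hc := congrArg (coeff (single (0 : Fin 2) w.1 + single (1 : Fin 2) w.2)) hQ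
  rw [hQ0, coeff_zero, coeff_sum] at hc
  simp only [coeff_monomial] at hc
  rw [Finset.sum_congr rfl (fun w' _ => if_congr (expo_injective.eq_iff) rfl rfl), Finset.sum_ite_eq' S w,
    if_pos hw] at hc
  have h2 : (2 : ℂ) ^ w.1 * 2 ^ w.2 ≠ 0 := mul_ne_zero (pow_ne_zero _ two_ne_zero) (pow_ne_zero _ two_ne_zero)
  have : a w * ((2 : ℂ) ^ w.1 * 2 ^ w.2) = 0 := by rw [← mul_assoc]; exact hc.symm
  exact (mul_eq_zero.mp this).resolve_right h2

/-- **CM-weight separation on a congruence class (the engine of Theorem F1⁺).** If `Σ a_{κ,λ} c^κ c̄^λ = 0` for all Gaussian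
integers `c` in ONE coset `c₀ + N·ℤ[i]` (`N ≠ 0`) — e.g. the torsion-fixing isogenies `c ≡ 1 (mod N)`, which fix every `N`-torsion point of
the Weil torus and every residue mod `N` of the rational data of a formal simplex while multiplying its archimedean data by `c` — then
every coefficient vanishes. [folklore] -/
theorem cmCharacter_linearIndependent_coset (S : Finset (ℕ × ℕ)) (a : ℕ × ℕ → ℂ) (N x₀ y₀ : ℤ) (hN : N ≠ 0)
    (h : ∀ k l : ℤ, ∑ w ∈ S, a w * (((x₀ + N * k : ℤ) : ℂ) + ((y₀ + N * l : ℤ) : ℂ) * I) ^ w.1 *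
        (((x₀ + N * k : ℤ) : ℂ) - ((y₀ + N * l : ℤ) : ℂ) * I) ^ w.2 = 0) :
    ∀ w ∈ S, a w = 0 := by
  apply coeff_eq_zero_of_charPoly_eq_zero
  apply mvPolynomial_eq_zero_of_eval_intCast_on (![{x | ∃ k : ℤ, x = x₀ + N * k}, {y | ∃ l : ℤ, y = y₀ + N * l}])
  · intro i
    fin_cases i
    · refine Set.infinite_of_injective_forall_mem (f := fun k : ℤ => x₀ + N * k) (fun k k' hk => ?_) (fun k => ⟨k, rfl⟩)
      have : N * k = N * k' := by linarith
      exact mul_left_cancel₀ hN this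
    · refine Set.infinite_of_injective_forall_mem (f := fun l : ℤ => y₀ + N * l) (fun l l' hl => ?_) (fun l => ⟨l, rfl⟩)
      have : N * l = N * l' := by linarith
      exact mul_left_cancel₀ hN this
  · intro x hx
    obtain ⟨k, hk⟩ : ∃ k : ℤ, x 0 = x₀ + N * k := by simpa using hx 0
    obtain ⟨l, hl⟩ : ∃ l : ℤ, x 1 = y₀ + N * l := by simpa using hx 1
    have := h k l
    rw [← hk, ← hl] at this
    simp only [mul_comm ((x 1 : ℤ) : ℂ) I] at this
    simpa [map_sum, map_mul, map_pow, map_add, map_sub, eval_C, eval_X] using this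

end Summit.HodgeConjecture.HodgeConjecture.Theorems.TropicalWeilVanishing.CMWeights
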